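import Summits.HodgeConjecture.HodgeConjecture.Theorems.Ring2WeilCoverageNormCriteria
import HarnessLib

/-!
# Ring 2 · Weil-type family-coverage census (ring2-b04, gen 40) — SAME-COMPONENT certificates `[a] = [a₀]` in `ℚˣ/Nm(K_dˣ)`

research route conditional on HC_CM; not a corollary; Q11.4-sentence-2 already refuted in dim ≥ 3.
`HC_CM` (`Theses.RankFourFaces.CMAbelianHodge`, by name) does not occur in this file; no case of the Hodge
conjecture is claimed. Cell `pub-hodge-ring2`, seat `ring2-b04` (gen 40); companion of `Ring2WeilCoverageNormCriteria`
/ `…NormTable{,B,C}` (which decide `a ∈ Nm(K_dˣ)`, i.e. WHICH class is the split one). This file certifies the other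
half of the census bookkeeping: WHEN TWO REPRESENTATIVES NAME THE SAME COMPONENT. The component of a polarized
Weil-type `2n`-fold is its class `δ = det H ∈ ℚˣ/Nm(K_dˣ)` (van Geemen Lemma 5.2 (3); Markman §1.1: "(n, K, det H)
… determines it up to isogenies"), and `[a] = [a₀] ⟺ a·a₀ ∈ Nm(K_dˣ)` (`mk_eq_mk_of_mul_mem`, since `a₀² ∈ Nm`).
For each target field `K = ℚ(√-d)`, `d ∈ {1, 2, 3, 7, 11}`, and each squarefree NON-norm `a ≤ 60`, the class of `a`
is identified with the class of the LEAST representative `a₀` (the row key `W6.d.a₀` / `W4.d.a₀` of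
`WEIL-FAMILY-COVERAGE.md` §b02.3 / §b01, column «other squarefree a ≤ 60 in the class») by ONE explicit representation
`a·a₀ = x² + d y²`; both letters are given: `[a] = [a₀]` (`n` even, `δ = det H = a`) and `[-a] = [-a₀]` (`n` odd,
`δ = -a`, the sixfold / tenfold tables). Example answering pub-hsemireg TARGET-TABLE R1/R2 («λ = 6 (≡ 2·3 ≡ ? use
cli)»): `SqrtNeg3.neg6_eq_neg2 : [(-6 : ℚ)] = [(-2 : ℚ)]` in `weilNormResidueGroup 3` — the weight-6 anchors lie on
R1, not on a new row. Sorry-free; axioms standard; no `def`, no named fact; every entry is `norm_num` on one identity.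

## References

* [vanGeemen1994HodgeAV] B. van Geemen, LNM 1594 (1994), 4.14, Lemma 5.2 (3), (5.4.1).
* [Markman2025SecantWeil] E. Markman, arXiv:2502.03415 (preprint), §1.1.
-/

noncomputable section

set_option linter.dupNamespace false

open Literature.AlgebraicGeometry.Motives
open Literature.AlgebraicGeometry.VanGeemen1994
open Summit.HodgeConjecture.HodgeConjecture.Ring2.Hypotheses

namespace Summit.HodgeConjecture.HodgeConjecture.Ring2.WeilCoverage

/-! ### §0 The criterion `[a] = [b] ⟺ a·b ∈ Nm(K_dˣ)` -/

/-- **`a·b ∈ Nm(K_dˣ) ⟹ [a] = [b]`** in `ℚˣ/Nm(K_dˣ)` (`a⁻¹b = (ab)·(a⁻¹)²` and squares are norms).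
research route conditional on HC_CM; not a corollary; Q11.4-sentence-2 already refuted in dim ≥ 3. [cite: vanGeemen1994HodgeAV, Lemma 5.2 (3)] -/
theorem mk_eq_mk_of_mul_mem {d : ℕ} {a b : ℚ} (ha : a ≠ 0) (hb : b ≠ 0)
    (h : Units.mk0 (a * b) (mul_ne_zero ha hb) ∈ normUnitsSubgroup ℚ (weilField d)) :
    (QuotientGroup.mk (Units.mk0 a ha) : weilNormResidueGroup d) = QuotientGroup.mk (Units.mk0 b hb) := by
  rw [QuotientGroup.eq]
  have hsq : (Units.mk0 a ha)⁻¹ ^ 2 ∈ normUnitsSubgroup ℚ (weilField d) := by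
    have := sq_mem_normUnitsSubgroup (d := d) (inv_ne_zero ha)
    convert this using 1
    ext
    simp
  have key : (Units.mk0 a ha)⁻¹ * Units.mk0 b hb = Units.mk0 (a * b) (mul_ne_zero ha hb) * (Units.mk0 a ha)⁻¹ ^ 2 := by
    ext
    simp
    field_simp
  rw [key]
  exact Subgroup.mul_mem _ h hsq

/-- The same with both representatives negated (the letter `δ = det H = -a` of the ODD-`n` tables): `a·b ∈ Nm(K_dˣ) ⟹
[-a] = [-b]`. research route conditional on HC_CM; not a corollary; Q11.4-sentence-2 already refuted in dim ≥ 3. [cite: vanGeemen1994HodgeAV, Lemma 5.2 (3)] -/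
theorem mk_neg_eq_mk_neg_of_mul_mem {d : ℕ} {a b : ℚ} (ha : a ≠ 0) (hb : b ≠ 0)
    (h : Units.mk0 (a * b) (mul_ne_zero ha hb) ∈ normUnitsSubgroup ℚ (weilField d)) :
    (QuotientGroup.mk (Units.mk0 (-a) (neg_ne_zero.2 ha)) : weilNormResidueGroup d) =
      QuotientGroup.mk (Units.mk0 (-b) (neg_ne_zero.2 hb)) := by
  have hab : (-a) * (-b) = a * b := by ring
  refine mk_eq_mk_of_mul_mem (neg_ne_zero.2 ha) (neg_ne_zero.2 hb) ?_
  convert h using 1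
  ext
  simp

/-- **Changing the letter**: `[-a] = [-b] ⟺ [a] = [b]` in `ℚˣ/Nm(K_dˣ)` (multiply by the class of `-1`). Converts every
positive-letter certificate below (and in part D2) into the sixfold/tenfold letter `δ = -a`.
research route conditional on HC_CM; not a corollary; Q11.4-sentence-2 already refuted in dim ≥ 3. [cite: vanGeemen1994HodgeAV, Lemma 5.2 (3)] -/
theorem mk_neg_eq_mk_neg_iff {d : ℕ} {a b : ℚ} (ha : a ≠ 0) (hb : b ≠ 0) :
    (QuotientGroup.mk (Units.mk0 (-a) (neg_ne_zero.2 ha)) : weilNormResidueGroup d) =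
        QuotientGroup.mk (Units.mk0 (-b) (neg_ne_zero.2 hb)) ↔
      (QuotientGroup.mk (Units.mk0 a ha) : weilNormResidueGroup d) = QuotientGroup.mk (Units.mk0 b hb) := by
  rw [QuotientGroup.eq, QuotientGroup.eq]
  have key : (Units.mk0 (-a) (neg_ne_zero.2 ha))⁻¹ * Units.mk0 (-b) (neg_ne_zero.2 hb) =
      (Units.mk0 a ha)⁻¹ * Units.mk0 b hb := by
    ext
    simp
  rw [key]

/-! ### §1 `K = ℚ(√-3)`: squarefree non-norms `a ≤ 60` identified with the least representative of their class -/

namespace SqrtNeg3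

/-- `[6] = [2]` in `ℚˣ/Nm(ℚ(√-3)ˣ)` (`T = {2, 3}`): `6·2 = 12 = 3² + 3·1²`. research route conditional on HC_CM; not a corollary; Q11.4-sentence-2 already refuted in dim ≥ 3. [cite: vanGeemen1994HodgeAV, Lemma 5.2 (3)] -/
theorem class_6_eq_2 :
    (QuotientGroup.mk (Units.mk0 (6 : ℚ) (by norm_num)) : weilNormResidueGroup 3) =
      QuotientGroup.mk (Units.mk0 (2 : ℚ) (by norm_num)) :=
  mk_eq_mk_of_mul_mem _ _ (mem_normUnitsSubgroup_of_sq_add_mul_sq _ 3 1 (by norm_num))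

/-- `[-6] = [-2]` in `ℚˣ/Nm(ℚ(√-3)ˣ)` — the sixfold/tenfold letter (`δ = -a`): representatives `6` and `2` name the SAME odd-`n` component. research route conditional on HC_CM; not a corollary; Q11.4-sentence-2 already refuted in dim ≥ 3. [cite: vanGeemen1994HodgeAV, Lemma 5.2 (3)] -/
theorem neg6_eq_neg2 :
    (QuotientGroup.mk (Units.mk0 (-6 : ℚ) (by norm_num)) : weilNormResidueGroup 3) =
      QuotientGroup.mk (Units.mk0 (-2 : ℚ) (by norm_num)) :=
  (mk_neg_eq_mk_neg_iff _ _).2 class_6_eq_2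

/-- `[14] = [2]` in `ℚˣ/Nm(ℚ(√-3)ˣ)` (`T = {2, 3}`): `14·2 = 28 = 5² + 3·1²`. research route conditional on HC_CM; not a corollary; Q11.4-sentence-2 already refuted in dim ≥ 3. [cite: vanGeemen1994HodgeAV, Lemma 5.2 (3)] -/
theorem class_14_eq_2 :
    (QuotientGroup.mk (Units.mk0 (14 : ℚ) (by norm_num)) : weilNormResidueGroup 3) =
      QuotientGroup.mk (Units.mk0 (2 : ℚ) (by norm_num)) :=
  mk_eq_mk_of_mul_mem _ _ (mem_normUnitsSubgroup_of_sq_add_mul_sq _ 5 1 (by norm_num))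

/-- `[-14] = [-2]` in `ℚˣ/Nm(ℚ(√-3)ˣ)` — the sixfold/tenfold letter (`δ = -a`): representatives `14` and `2` name the SAME odd-`n` component. research route conditional on HC_CM; not a corollary; Q11.4-sentence-2 already refuted in dim ≥ 3. [cite: vanGeemen1994HodgeAV, Lemma 5.2 (3)] -/
theorem neg14_eq_neg2 :
    (QuotientGroup.mk (Units.mk0 (-14 : ℚ) (by norm_num)) : weilNormResidueGroup 3) =
      QuotientGroup.mk (Units.mk0 (-2 : ℚ) (by norm_num)) :=
  (mk_neg_eq_mk_neg_iff _ _).2 class_14_eq_2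

/-- `[26] = [2]` in `ℚˣ/Nm(ℚ(√-3)ˣ)` (`T = {2, 3}`): `26·2 = 52 = 7² + 3·1²`. research route conditional on HC_CM; not a corollary; Q11.4-sentence-2 already refuted in dim ≥ 3. [cite: vanGeemen1994HodgeAV, Lemma 5.2 (3)] -/
theorem class_26_eq_2 :
    (QuotientGroup.mk (Units.mk0 (26 : ℚ) (by norm_num)) : weilNormResidueGroup 3) =
      QuotientGroup.mk (Units.mk0 (2 : ℚ) (by norm_num)) :=
  mk_eq_mk_of_mul_mem _ _ (mem_normUnitsSubgroup_of_sq_add_mul_sq _ 7 1 (by norm_num))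

/-- `[-26] = [-2]` in `ℚˣ/Nm(ℚ(√-3)ˣ)` — the sixfold/tenfold letter (`δ = -a`): representatives `26` and `2` name the SAME odd-`n` component. research route conditional on HC_CM; not a corollary; Q11.4-sentence-2 already refuted in dim ≥ 3. [cite: vanGeemen1994HodgeAV, Lemma 5.2 (3)] -/
theorem neg26_eq_neg2 :
    (QuotientGroup.mk (Units.mk0 (-26 : ℚ) (by norm_num)) : weilNormResidueGroup 3) =
      QuotientGroup.mk (Units.mk0 (-2 : ℚ) (by norm_num)) :=
  (mk_neg_eq_mk_neg_iff _ _).2 class_26_eq_2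

/-- `[38] = [2]` in `ℚˣ/Nm(ℚ(√-3)ˣ)` (`T = {2, 3}`): `38·2 = 76 = 8² + 3·2²`. research route conditional on HC_CM; not a corollary; Q11.4-sentence-2 already refuted in dim ≥ 3. [cite: vanGeemen1994HodgeAV, Lemma 5.2 (3)] -/
theorem class_38_eq_2 :
    (QuotientGroup.mk (Units.mk0 (38 : ℚ) (by norm_num)) : weilNormResidueGroup 3) =
      QuotientGroup.mk (Units.mk0 (2 : ℚ) (by norm_num)) :=
  mk_eq_mk_of_mul_mem _ _ (mem_normUnitsSubgroup_of_sq_add_mul_sq _ 8 2 (by norm_num))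

/-- `[-38] = [-2]` in `ℚˣ/Nm(ℚ(√-3)ˣ)` — the sixfold/tenfold letter (`δ = -a`): representatives `38` and `2` name the SAME odd-`n` component. research route conditional on HC_CM; not a corollary; Q11.4-sentence-2 already refuted in dim ≥ 3. [cite: vanGeemen1994HodgeAV, Lemma 5.2 (3)] -/
theorem neg38_eq_neg2 :
    (QuotientGroup.mk (Units.mk0 (-38 : ℚ) (by norm_num)) : weilNormResidueGroup 3) =
      QuotientGroup.mk (Units.mk0 (-2 : ℚ) (by norm_num)) :=
  (mk_neg_eq_mk_neg_iff _ _).2 class_38_eq_2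

/-- `[42] = [2]` in `ℚˣ/Nm(ℚ(√-3)ˣ)` (`T = {2, 3}`): `42·2 = 84 = 9² + 3·1²`. research route conditional on HC_CM; not a corollary; Q11.4-sentence-2 already refuted in dim ≥ 3. [cite: vanGeemen1994HodgeAV, Lemma 5.2 (3)] -/
theorem class_42_eq_2 :
    (QuotientGroup.mk (Units.mk0 (42 : ℚ) (by norm_num)) : weilNormResidueGroup 3) =
      QuotientGroup.mk (Units.mk0 (2 : ℚ) (by norm_num)) :=
  mk_eq_mk_of_mul_mem _ _ (mem_normUnitsSubgroup_of_sq_add_mul_sq _ 9 1 (by norm_num))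

/-- `[-42] = [-2]` in `ℚˣ/Nm(ℚ(√-3)ˣ)` — the sixfold/tenfold letter (`δ = -a`): representatives `42` and `2` name the SAME odd-`n` component. research route conditional on HC_CM; not a corollary; Q11.4-sentence-2 already refuted in dim ≥ 3. [cite: vanGeemen1994HodgeAV, Lemma 5.2 (3)] -/
theorem neg42_eq_neg2 :
    (QuotientGroup.mk (Units.mk0 (-42 : ℚ) (by norm_num)) : weilNormResidueGroup 3) =
      QuotientGroup.mk (Units.mk0 (-2 : ℚ) (by norm_num)) :=
  (mk_neg_eq_mk_neg_iff _ _).2 class_42_eq_2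

/-- `[15] = [5]` in `ℚˣ/Nm(ℚ(√-3)ˣ)` (`T = {3, 5}`): `15·5 = 75 = 0² + 3·5²`. research route conditional on HC_CM; not a corollary; Q11.4-sentence-2 already refuted in dim ≥ 3. [cite: vanGeemen1994HodgeAV, Lemma 5.2 (3)] -/
theorem class_15_eq_5 :
    (QuotientGroup.mk (Units.mk0 (15 : ℚ) (by norm_num)) : weilNormResidueGroup 3) =
      QuotientGroup.mk (Units.mk0 (5 : ℚ) (by norm_num)) :=
  mk_eq_mk_of_mul_mem _ _ (mem_normUnitsSubgroup_of_sq_add_mul_sq _ 0 5 (by norm_num))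

/-- `[-15] = [-5]` in `ℚˣ/Nm(ℚ(√-3)ˣ)` — the sixfold/tenfold letter (`δ = -a`): representatives `15` and `5` name the SAME odd-`n` component. research route conditional on HC_CM; not a corollary; Q11.4-sentence-2 already refuted in dim ≥ 3. [cite: vanGeemen1994HodgeAV, Lemma 5.2 (3)] -/
theorem neg15_eq_neg5 :
    (QuotientGroup.mk (Units.mk0 (-15 : ℚ) (by norm_num)) : weilNormResidueGroup 3) =
      QuotientGroup.mk (Units.mk0 (-5 : ℚ) (by norm_num)) :=
  (mk_neg_eq_mk_neg_iff _ _).2 class_15_eq_5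

/-- `[35] = [5]` in `ℚˣ/Nm(ℚ(√-3)ˣ)` (`T = {3, 5}`): `35·5 = 175 = 10² + 3·5²`. research route conditional on HC_CM; not a corollary; Q11.4-sentence-2 already refuted in dim ≥ 3. [cite: vanGeemen1994HodgeAV, Lemma 5.2 (3)] -/
theorem class_35_eq_5 :
    (QuotientGroup.mk (Units.mk0 (35 : ℚ) (by norm_num)) : weilNormResidueGroup 3) =
      QuotientGroup.mk (Units.mk0 (5 : ℚ) (by norm_num)) :=
  mk_eq_mk_of_mul_mem _ _ (mem_normUnitsSubgroup_of_sq_add_mul_sq _ 10 5 (by norm_num))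

/-- `[-35] = [-5]` in `ℚˣ/Nm(ℚ(√-3)ˣ)` — the sixfold/tenfold letter (`δ = -a`): representatives `35` and `5` name the SAME odd-`n` component. research route conditional on HC_CM; not a corollary; Q11.4-sentence-2 already refuted in dim ≥ 3. [cite: vanGeemen1994HodgeAV, Lemma 5.2 (3)] -/
theorem neg35_eq_neg5 :
    (QuotientGroup.mk (Units.mk0 (-35 : ℚ) (by norm_num)) : weilNormResidueGroup 3) =
      QuotientGroup.mk (Units.mk0 (-5 : ℚ) (by norm_num)) :=
  (mk_neg_eq_mk_neg_iff _ _).2 class_35_eq_5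

/-- `[30] = [10]` in `ℚˣ/Nm(ℚ(√-3)ˣ)` (`T = {2, 5}`): `30·10 = 300 = 15² + 3·5²`. research route conditional on HC_CM; not a corollary; Q11.4-sentence-2 already refuted in dim ≥ 3. [cite: vanGeemen1994HodgeAV, Lemma 5.2 (3)] -/
theorem class_30_eq_10 :
    (QuotientGroup.mk (Units.mk0 (30 : ℚ) (by norm_num)) : weilNormResidueGroup 3) =
      QuotientGroup.mk (Units.mk0 (10 : ℚ) (by norm_num)) :=
  mk_eq_mk_of_mul_mem _ _ (mem_normUnitsSubgroup_of_sq_add_mul_sq _ 15 5 (by norm_num))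

/-- `[-30] = [-10]` in `ℚˣ/Nm(ℚ(√-3)ˣ)` — the sixfold/tenfold letter (`δ = -a`): representatives `30` and `10` name the SAME odd-`n` component. research route conditional on HC_CM; not a corollary; Q11.4-sentence-2 already refuted in dim ≥ 3. [cite: vanGeemen1994HodgeAV, Lemma 5.2 (3)] -/
theorem neg30_eq_neg10 :
    (QuotientGroup.mk (Units.mk0 (-30 : ℚ) (by norm_num)) : weilNormResidueGroup 3) =
      QuotientGroup.mk (Units.mk0 (-10 : ℚ) (by norm_num)) :=
  (mk_neg_eq_mk_neg_iff _ _).2 class_30_eq_10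

/-- `[33] = [11]` in `ℚˣ/Nm(ℚ(√-3)ˣ)` (`T = {3, 11}`): `33·11 = 363 = 0² + 3·11²`. research route conditional on HC_CM; not a corollary; Q11.4-sentence-2 already refuted in dim ≥ 3. [cite: vanGeemen1994HodgeAV, Lemma 5.2 (3)] -/
theorem class_33_eq_11 :
    (QuotientGroup.mk (Units.mk0 (33 : ℚ) (by norm_num)) : weilNormResidueGroup 3) =
      QuotientGroup.mk (Units.mk0 (11 : ℚ) (by norm_num)) :=
  mk_eq_mk_of_mul_mem _ _ (mem_normUnitsSubgroup_of_sq_add_mul_sq _ 0 11 (by norm_num))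

/-- `[-33] = [-11]` in `ℚˣ/Nm(ℚ(√-3)ˣ)` — the sixfold/tenfold letter (`δ = -a`): representatives `33` and `11` name the SAME odd-`n` component. research route conditional on HC_CM; not a corollary; Q11.4-sentence-2 already refuted in dim ≥ 3. [cite: vanGeemen1994HodgeAV, Lemma 5.2 (3)] -/
theorem neg33_eq_neg11 :
    (QuotientGroup.mk (Units.mk0 (-33 : ℚ) (by norm_num)) : weilNormResidueGroup 3) =
      QuotientGroup.mk (Units.mk0 (-11 : ℚ) (by norm_num)) :=
  (mk_neg_eq_mk_neg_iff _ _).2 class_33_eq_11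

/-- `[51] = [17]` in `ℚˣ/Nm(ℚ(√-3)ˣ)` (`T = {3, 17}`): `51·17 = 867 = 0² + 3·17²`. research route conditional on HC_CM; not a corollary; Q11.4-sentence-2 already refuted in dim ≥ 3. [cite: vanGeemen1994HodgeAV, Lemma 5.2 (3)] -/
theorem class_51_eq_17 :
    (QuotientGroup.mk (Units.mk0 (51 : ℚ) (by norm_num)) : weilNormResidueGroup 3) =
      QuotientGroup.mk (Units.mk0 (17 : ℚ) (by norm_num)) :=
  mk_eq_mk_of_mul_mem _ _ (mem_normUnitsSubgroup_of_sq_add_mul_sq _ 0 17 (by norm_num))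

/-- `[-51] = [-17]` in `ℚˣ/Nm(ℚ(√-3)ˣ)` — the sixfold/tenfold letter (`δ = -a`): representatives `51` and `17` name the SAME odd-`n` component. research route conditional on HC_CM; not a corollary; Q11.4-sentence-2 already refuted in dim ≥ 3. [cite: vanGeemen1994HodgeAV, Lemma 5.2 (3)] -/
theorem neg51_eq_neg17 :
    (QuotientGroup.mk (Units.mk0 (-51 : ℚ) (by norm_num)) : weilNormResidueGroup 3) =
      QuotientGroup.mk (Units.mk0 (-17 : ℚ) (by norm_num)) :=
  (mk_neg_eq_mk_neg_iff _ _).2 class_51_eq_17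

end SqrtNeg3

/-! ### §2 `K = ℚ(√-1)`: squarefree non-norms `a ≤ 60` identified with the least representative of their class -/

namespace SqrtNeg1

/-- `[6] = [3]` in `ℚˣ/Nm(ℚ(√-1)ˣ)` (`T = {2, 3}`): `6·3 = 18 = 3² + 1·3²`. research route conditional on HC_CM; not a corollary; Q11.4-sentence-2 already refuted in dim ≥ 3. [cite: vanGeemen1994HodgeAV, Lemma 5.2 (3)] -/
theorem class_6_eq_3 :
    (QuotientGroup.mk (Units.mk0 (6 : ℚ) (by norm_num)) : weilNormResidueGroup 1) =
      QuotientGroup.mk (Units.mk0 (3 : ℚ) (by norm_num)) :=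
  mk_eq_mk_of_mul_mem _ _ (mem_normUnitsSubgroup_of_sq_add_mul_sq _ 3 3 (by norm_num))

/-- `[-6] = [-3]` in `ℚˣ/Nm(ℚ(√-1)ˣ)` — the sixfold/tenfold letter (`δ = -a`): representatives `6` and `3` name the SAME odd-`n` component. research route conditional on HC_CM; not a corollary; Q11.4-sentence-2 already refuted in dim ≥ 3. [cite: vanGeemen1994HodgeAV, Lemma 5.2 (3)] -/
theorem neg6_eq_neg3 :
    (QuotientGroup.mk (Units.mk0 (-6 : ℚ) (by norm_num)) : weilNormResidueGroup 1) =
      QuotientGroup.mk (Units.mk0 (-3 : ℚ) (by norm_num)) :=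
  (mk_neg_eq_mk_neg_iff _ _).2 class_6_eq_3

/-- `[15] = [3]` in `ℚˣ/Nm(ℚ(√-1)ˣ)` (`T = {2, 3}`): `15·3 = 45 = 6² + 1·3²`. research route conditional on HC_CM; not a corollary; Q11.4-sentence-2 already refuted in dim ≥ 3. [cite: vanGeemen1994HodgeAV, Lemma 5.2 (3)] -/
theorem class_15_eq_3 :
    (QuotientGroup.mk (Units.mk0 (15 : ℚ) (by norm_num)) : weilNormResidueGroup 1) =
      QuotientGroup.mk (Units.mk0 (3 : ℚ) (by norm_num)) :=
  mk_eq_mk_of_mul_mem _ _ (mem_normUnitsSubgroup_of_sq_add_mul_sq _ 6 3 (by norm_num))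

/-- `[-15] = [-3]` in `ℚˣ/Nm(ℚ(√-1)ˣ)` — the sixfold/tenfold letter (`δ = -a`): representatives `15` and `3` name the SAME odd-`n` component. research route conditional on HC_CM; not a corollary; Q11.4-sentence-2 already refuted in dim ≥ 3. [cite: vanGeemen1994HodgeAV, Lemma 5.2 (3)] -/
theorem neg15_eq_neg3 :
    (QuotientGroup.mk (Units.mk0 (-15 : ℚ) (by norm_num)) : weilNormResidueGroup 1) =
      QuotientGroup.mk (Units.mk0 (-3 : ℚ) (by norm_num)) :=
  (mk_neg_eq_mk_neg_iff _ _).2 class_15_eq_3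

/-- `[30] = [3]` in `ℚˣ/Nm(ℚ(√-1)ˣ)` (`T = {2, 3}`): `30·3 = 90 = 9² + 1·3²`. research route conditional on HC_CM; not a corollary; Q11.4-sentence-2 already refuted in dim ≥ 3. [cite: vanGeemen1994HodgeAV, Lemma 5.2 (3)] -/
theorem class_30_eq_3 :
    (QuotientGroup.mk (Units.mk0 (30 : ℚ) (by norm_num)) : weilNormResidueGroup 1) =
      QuotientGroup.mk (Units.mk0 (3 : ℚ) (by norm_num)) :=
  mk_eq_mk_of_mul_mem _ _ (mem_normUnitsSubgroup_of_sq_add_mul_sq _ 9 3 (by norm_num))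

/-- `[-30] = [-3]` in `ℚˣ/Nm(ℚ(√-1)ˣ)` — the sixfold/tenfold letter (`δ = -a`): representatives `30` and `3` name the SAME odd-`n` component. research route conditional on HC_CM; not a corollary; Q11.4-sentence-2 already refuted in dim ≥ 3. [cite: vanGeemen1994HodgeAV, Lemma 5.2 (3)] -/
theorem neg30_eq_neg3 :
    (QuotientGroup.mk (Units.mk0 (-30 : ℚ) (by norm_num)) : weilNormResidueGroup 1) =
      QuotientGroup.mk (Units.mk0 (-3 : ℚ) (by norm_num)) :=
  (mk_neg_eq_mk_neg_iff _ _).2 class_30_eq_3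

/-- `[39] = [3]` in `ℚˣ/Nm(ℚ(√-1)ˣ)` (`T = {2, 3}`): `39·3 = 117 = 9² + 1·6²`. research route conditional on HC_CM; not a corollary; Q11.4-sentence-2 already refuted in dim ≥ 3. [cite: vanGeemen1994HodgeAV, Lemma 5.2 (3)] -/
theorem class_39_eq_3 :
    (QuotientGroup.mk (Units.mk0 (39 : ℚ) (by norm_num)) : weilNormResidueGroup 1) =
      QuotientGroup.mk (Units.mk0 (3 : ℚ) (by norm_num)) :=
  mk_eq_mk_of_mul_mem _ _ (mem_normUnitsSubgroup_of_sq_add_mul_sq _ 9 6 (by norm_num))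

/-- `[-39] = [-3]` in `ℚˣ/Nm(ℚ(√-1)ˣ)` — the sixfold/tenfold letter (`δ = -a`): representatives `39` and `3` name the SAME odd-`n` component. research route conditional on HC_CM; not a corollary; Q11.4-sentence-2 already refuted in dim ≥ 3. [cite: vanGeemen1994HodgeAV, Lemma 5.2 (3)] -/
theorem neg39_eq_neg3 :
    (QuotientGroup.mk (Units.mk0 (-39 : ℚ) (by norm_num)) : weilNormResidueGroup 1) =
      QuotientGroup.mk (Units.mk0 (-3 : ℚ) (by norm_num)) :=
  (mk_neg_eq_mk_neg_iff _ _).2 class_39_eq_3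

/-- `[51] = [3]` in `ℚˣ/Nm(ℚ(√-1)ˣ)` (`T = {2, 3}`): `51·3 = 153 = 12² + 1·3²`. research route conditional on HC_CM; not a corollary; Q11.4-sentence-2 already refuted in dim ≥ 3. [cite: vanGeemen1994HodgeAV, Lemma 5.2 (3)] -/
theorem class_51_eq_3 :
    (QuotientGroup.mk (Units.mk0 (51 : ℚ) (by norm_num)) : weilNormResidueGroup 1) =
      QuotientGroup.mk (Units.mk0 (3 : ℚ) (by norm_num)) :=
  mk_eq_mk_of_mul_mem _ _ (mem_normUnitsSubgroup_of_sq_add_mul_sq _ 12 3 (by norm_num))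

/-- `[-51] = [-3]` in `ℚˣ/Nm(ℚ(√-1)ˣ)` — the sixfold/tenfold letter (`δ = -a`): representatives `51` and `3` name the SAME odd-`n` component. research route conditional on HC_CM; not a corollary; Q11.4-sentence-2 already refuted in dim ≥ 3. [cite: vanGeemen1994HodgeAV, Lemma 5.2 (3)] -/
theorem neg51_eq_neg3 :
    (QuotientGroup.mk (Units.mk0 (-51 : ℚ) (by norm_num)) : weilNormResidueGroup 1) =
      QuotientGroup.mk (Units.mk0 (-3 : ℚ) (by norm_num)) :=
  (mk_neg_eq_mk_neg_iff _ _).2 class_51_eq_3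

/-- `[14] = [7]` in `ℚˣ/Nm(ℚ(√-1)ˣ)` (`T = {2, 7}`): `14·7 = 98 = 7² + 1·7²`. research route conditional on HC_CM; not a corollary; Q11.4-sentence-2 already refuted in dim ≥ 3. [cite: vanGeemen1994HodgeAV, Lemma 5.2 (3)] -/
theorem class_14_eq_7 :
    (QuotientGroup.mk (Units.mk0 (14 : ℚ) (by norm_num)) : weilNormResidueGroup 1) =
      QuotientGroup.mk (Units.mk0 (7 : ℚ) (by norm_num)) :=
  mk_eq_mk_of_mul_mem _ _ (mem_normUnitsSubgroup_of_sq_add_mul_sq _ 7 7 (by norm_num))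

/-- `[-14] = [-7]` in `ℚˣ/Nm(ℚ(√-1)ˣ)` — the sixfold/tenfold letter (`δ = -a`): representatives `14` and `7` name the SAME odd-`n` component. research route conditional on HC_CM; not a corollary; Q11.4-sentence-2 already refuted in dim ≥ 3. [cite: vanGeemen1994HodgeAV, Lemma 5.2 (3)] -/
theorem neg14_eq_neg7 :
    (QuotientGroup.mk (Units.mk0 (-14 : ℚ) (by norm_num)) : weilNormResidueGroup 1) =
      QuotientGroup.mk (Units.mk0 (-7 : ℚ) (by norm_num)) :=
  (mk_neg_eq_mk_neg_iff _ _).2 class_14_eq_7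

/-- `[35] = [7]` in `ℚˣ/Nm(ℚ(√-1)ˣ)` (`T = {2, 7}`): `35·7 = 245 = 14² + 1·7²`. research route conditional on HC_CM; not a corollary; Q11.4-sentence-2 already refuted in dim ≥ 3. [cite: vanGeemen1994HodgeAV, Lemma 5.2 (3)] -/
theorem class_35_eq_7 :
    (QuotientGroup.mk (Units.mk0 (35 : ℚ) (by norm_num)) : weilNormResidueGroup 1) =
      QuotientGroup.mk (Units.mk0 (7 : ℚ) (by norm_num)) :=
  mk_eq_mk_of_mul_mem _ _ (mem_normUnitsSubgroup_of_sq_add_mul_sq _ 14 7 (by norm_num))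

/-- `[-35] = [-7]` in `ℚˣ/Nm(ℚ(√-1)ˣ)` — the sixfold/tenfold letter (`δ = -a`): representatives `35` and `7` name the SAME odd-`n` component. research route conditional on HC_CM; not a corollary; Q11.4-sentence-2 already refuted in dim ≥ 3. [cite: vanGeemen1994HodgeAV, Lemma 5.2 (3)] -/
theorem neg35_eq_neg7 :
    (QuotientGroup.mk (Units.mk0 (-35 : ℚ) (by norm_num)) : weilNormResidueGroup 1) =
      QuotientGroup.mk (Units.mk0 (-7 : ℚ) (by norm_num)) :=
  (mk_neg_eq_mk_neg_iff _ _).2 class_35_eq_7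

/-- `[22] = [11]` in `ℚˣ/Nm(ℚ(√-1)ˣ)` (`T = {2, 11}`): `22·11 = 242 = 11² + 1·11²`. research route conditional on HC_CM; not a corollary; Q11.4-sentence-2 already refuted in dim ≥ 3. [cite: vanGeemen1994HodgeAV, Lemma 5.2 (3)] -/
theorem class_22_eq_11 :
    (QuotientGroup.mk (Units.mk0 (22 : ℚ) (by norm_num)) : weilNormResidueGroup 1) =
      QuotientGroup.mk (Units.mk0 (11 : ℚ) (by norm_num)) :=
  mk_eq_mk_of_mul_mem _ _ (mem_normUnitsSubgroup_of_sq_add_mul_sq _ 11 11 (by norm_num))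

/-- `[-22] = [-11]` in `ℚˣ/Nm(ℚ(√-1)ˣ)` — the sixfold/tenfold letter (`δ = -a`): representatives `22` and `11` name the SAME odd-`n` component. research route conditional on HC_CM; not a corollary; Q11.4-sentence-2 already refuted in dim ≥ 3. [cite: vanGeemen1994HodgeAV, Lemma 5.2 (3)] -/
theorem neg22_eq_neg11 :
    (QuotientGroup.mk (Units.mk0 (-22 : ℚ) (by norm_num)) : weilNormResidueGroup 1) =
      QuotientGroup.mk (Units.mk0 (-11 : ℚ) (by norm_num)) :=
  (mk_neg_eq_mk_neg_iff _ _).2 class_22_eq_11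

/-- `[55] = [11]` in `ℚˣ/Nm(ℚ(√-1)ˣ)` (`T = {2, 11}`): `55·11 = 605 = 22² + 1·11²`. research route conditional on HC_CM; not a corollary; Q11.4-sentence-2 already refuted in dim ≥ 3. [cite: vanGeemen1994HodgeAV, Lemma 5.2 (3)] -/
theorem class_55_eq_11 :
    (QuotientGroup.mk (Units.mk0 (55 : ℚ) (by norm_num)) : weilNormResidueGroup 1) =
      QuotientGroup.mk (Units.mk0 (11 : ℚ) (by norm_num)) :=
  mk_eq_mk_of_mul_mem _ _ (mem_normUnitsSubgroup_of_sq_add_mul_sq _ 22 11 (by norm_num))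

/-- `[-55] = [-11]` in `ℚˣ/Nm(ℚ(√-1)ˣ)` — the sixfold/tenfold letter (`δ = -a`): representatives `55` and `11` name the SAME odd-`n` component. research route conditional on HC_CM; not a corollary; Q11.4-sentence-2 already refuted in dim ≥ 3. [cite: vanGeemen1994HodgeAV, Lemma 5.2 (3)] -/
theorem neg55_eq_neg11 :
    (QuotientGroup.mk (Units.mk0 (-55 : ℚ) (by norm_num)) : weilNormResidueGroup 1) =
      QuotientGroup.mk (Units.mk0 (-11 : ℚ) (by norm_num)) :=
  (mk_neg_eq_mk_neg_iff _ _).2 class_55_eq_11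

/-- `[38] = [19]` in `ℚˣ/Nm(ℚ(√-1)ˣ)` (`T = {2, 19}`): `38·19 = 722 = 19² + 1·19²`. research route conditional on HC_CM; not a corollary; Q11.4-sentence-2 already refuted in dim ≥ 3. [cite: vanGeemen1994HodgeAV, Lemma 5.2 (3)] -/
theorem class_38_eq_19 :
    (QuotientGroup.mk (Units.mk0 (38 : ℚ) (by norm_num)) : weilNormResidueGroup 1) =
      QuotientGroup.mk (Units.mk0 (19 : ℚ) (by norm_num)) :=
  mk_eq_mk_of_mul_mem _ _ (mem_normUnitsSubgroup_of_sq_add_mul_sq _ 19 19 (by norm_num))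

/-- `[-38] = [-19]` in `ℚˣ/Nm(ℚ(√-1)ˣ)` — the sixfold/tenfold letter (`δ = -a`): representatives `38` and `19` name the SAME odd-`n` component. research route conditional on HC_CM; not a corollary; Q11.4-sentence-2 already refuted in dim ≥ 3. [cite: vanGeemen1994HodgeAV, Lemma 5.2 (3)] -/
theorem neg38_eq_neg19 :
    (QuotientGroup.mk (Units.mk0 (-38 : ℚ) (by norm_num)) : weilNormResidueGroup 1) =
      QuotientGroup.mk (Units.mk0 (-19 : ℚ) (by norm_num)) :=
  (mk_neg_eq_mk_neg_iff _ _).2 class_38_eq_19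

/-- `[42] = [21]` in `ℚˣ/Nm(ℚ(√-1)ˣ)` (`T = {3, 7}`): `42·21 = 882 = 21² + 1·21²`. research route conditional on HC_CM; not a corollary; Q11.4-sentence-2 already refuted in dim ≥ 3. [cite: vanGeemen1994HodgeAV, Lemma 5.2 (3)] -/
theorem class_42_eq_21 :
    (QuotientGroup.mk (Units.mk0 (42 : ℚ) (by norm_num)) : weilNormResidueGroup 1) =
      QuotientGroup.mk (Units.mk0 (21 : ℚ) (by norm_num)) :=
  mk_eq_mk_of_mul_mem _ _ (mem_normUnitsSubgroup_of_sq_add_mul_sq _ 21 21 (by norm_num))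

/-- `[-42] = [-21]` in `ℚˣ/Nm(ℚ(√-1)ˣ)` — the sixfold/tenfold letter (`δ = -a`): representatives `42` and `21` name the SAME odd-`n` component. research route conditional on HC_CM; not a corollary; Q11.4-sentence-2 already refuted in dim ≥ 3. [cite: vanGeemen1994HodgeAV, Lemma 5.2 (3)] -/
theorem neg42_eq_neg21 :
    (QuotientGroup.mk (Units.mk0 (-42 : ℚ) (by norm_num)) : weilNormResidueGroup 1) =
      QuotientGroup.mk (Units.mk0 (-21 : ℚ) (by norm_num)) :=
  (mk_neg_eq_mk_neg_iff _ _).2 class_42_eq_21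

/-- `[46] = [23]` in `ℚˣ/Nm(ℚ(√-1)ˣ)` (`T = {2, 23}`): `46·23 = 1058 = 23² + 1·23²`. research route conditional on HC_CM; not a corollary; Q11.4-sentence-2 already refuted in dim ≥ 3. [cite: vanGeemen1994HodgeAV, Lemma 5.2 (3)] -/
theorem class_46_eq_23 :
    (QuotientGroup.mk (Units.mk0 (46 : ℚ) (by norm_num)) : weilNormResidueGroup 1) =
      QuotientGroup.mk (Units.mk0 (23 : ℚ) (by norm_num)) :=
  mk_eq_mk_of_mul_mem _ _ (mem_normUnitsSubgroup_of_sq_add_mul_sq _ 23 23 (by norm_num))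

/-- `[-46] = [-23]` in `ℚˣ/Nm(ℚ(√-1)ˣ)` — the sixfold/tenfold letter (`δ = -a`): representatives `46` and `23` name the SAME odd-`n` component. research route conditional on HC_CM; not a corollary; Q11.4-sentence-2 already refuted in dim ≥ 3. [cite: vanGeemen1994HodgeAV, Lemma 5.2 (3)] -/
theorem neg46_eq_neg23 :
    (QuotientGroup.mk (Units.mk0 (-46 : ℚ) (by norm_num)) : weilNormResidueGroup 1) =
      QuotientGroup.mk (Units.mk0 (-23 : ℚ) (by norm_num)) :=
  (mk_neg_eq_mk_neg_iff _ _).2 class_46_eq_23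

end SqrtNeg1

end Summit.HodgeConjecture.HodgeConjecture.Ring2.WeilCoverage

end
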